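import Mathlib
import Literature.Combinatorics.Optimization.PseudoDensityFourier
import Literature.Combinatorics.Optimization.CutTspStabPsdRank
import Literature.Computability.Complexity.KnapsackSosLowerBound

/-!
# Grigoriev's knapsack pseudo-density on the cube (Lee–Raghavendra–Steurer 2015, Thm 5.3), PROVED,
# and Theorem 1.1 (`rk_psd(CORR_n) ≥ 2^{α n^{2/13}}`) DERIVED from Theorem 3.8

Seventh file of the tree's Lee–Raghavendra–Steurer story.  LRS §5.1 (p. 22–23) turns Grigoriev's
knapsack pseudo-expectation — a linear functional `𝒢` on `ℝ[X_1,…,X_m]/(X_i² − X_i)` with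
`𝒢(X^S) = binom(m/2,|S|)/binom(m,|S|)`, `𝒢(p²) ≥ 0` for `deg p ≤ m/2` and
`𝒢((Σ X_i − m/2)²) = 0` — into a **pseudo-density** `D : {0,1}^m → ℝ` with
`E_x D(x) p(x) = 𝒢(p)` for every multilinear `p`:

> **Theorem 5.3.** Fix an odd integer `m ≥ 3`. There exists a degree-`m` pseudo-density
> `D : {0,1}^m → ℝ` such that `E_x D(x) (Σ_{i=1}^m x_i − m/2)² = 0` and `‖D‖_∞ ≤ m^{3/2}`.

It is the input, with the nonnegative quadratic `f(x) = m^{-2}((Σ x_i − m/2)² − 1/4)` (eq. (5.1),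
p. 23: `E_x D(x) f(x) = −1/(4m²)`), of the proof of Thm 5.4 = Thm 1.1 (`rk_psd(CORR_n) ≥ 2^{α n^{2/13}}`,
the named fact `LeeRaghavendraSteurer2015_thm11`) via Thm 3.8.

This file PROVES Thm 5.3 (`LeeRaghavendraSteurer2015_thm53`), including the sup-norm bound in the
sharper form `‖D‖_∞ ≤ m` (second part of the file: the printed derivation goes through the
Lagrange-interpolation closed form `D(x) = 2^m c_{|x|}(m/2)/binom(m,|x|)`; we reach the same closed
form `|D(x)| = ∏_{a ≠ |x|} |m − 2a| / m!` by a finite-difference identity).  Nothing is vendored as a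
fact.  The functional `𝒢` is the tree's
`Literature.Computability.Complexity.Knapsack.functional m (m/2)` (Grigoriev 2001, PROVED there:
`functional_one`, `functional_mul_self_nonneg` = Lemma 1.4, `functional_knapsack_mul` = Lemma 1.3),
and `D` is DEFINED by Möbius inversion of its monomial moments,
`D(x) = 2^m Σ_{T ⊇ supp x} (−1)^{|T| − |x|} 𝒢(X^T)` (`knapsackDensity`), which is the unique function
on the cube with `E_x D(x) x^S = 𝒢(X^S)` for all `S` — hence equal to the printed `D`, which is
characterised by the same moments (p. 22: "We claim that `D` satisfies `E_x D(x) p(x) = 𝒢(p(X))` for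
every multilinear real polynomial `p`").  Proved: the moments
(`cubeExpect_knapsackDensity_mul_indicator`), `E_x D(x) P(x) = 𝒢(P)` for every real polynomial `P`
(`cubeExpect_knapsackDensity_mul_eval`), `D` is a degree-`d` pseudo-density for every `d ≤ m`
(`isPseudoDensity_knapsackDensity`; for `r = m/2` Grigoriev's window `l − 1 < r < m − l + 1` holds
for every `l ≤ m/2`), `E_x D(x)(Σ x_i − m/2)² = 0` (`cubeExpect_knapsackDensity_mul_sq`), and for the
function `f` of eq. (5.1) (`knapsackGap`): `E_x D(x) f(x) = −1/(4m²)`, `0 ≤ f ≤ 1` for odd `m`, and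
`f` is a nonnegative cube-quadratic in the sense of `IsCubeQuadratic` (Prop. 1.11/5.1).

**Third part (Theorem 5.4 = Theorem 1.1 from Theorem 3.8).**  `LeeRaghavendraSteurer2015_thm11_of_thm38 :
LeeRaghavendraSteurer2015_thm38 → LeeRaghavendraSteurer2015_thm11` — the printed proof of Thm 5.4
(p. 23) end to end modulo the typed engine Thm 3.8: the pseudo-density above with `‖D‖_∞ ≤ m`, the
nonnegative quadratic `f` (`E_x D f = −1/(4m²) < −1/(8m²) = −ε`, `E f ≥ 2^{-(m+3)}`), Thm 3.8 for the
pattern matrix `M_n^f` with `d = m = 2⌊n^{2/13}/2⌋ + 1` (odd, `m ≍ n^{2/13}`, so that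
`c n ≥ 128 m^6 log n` and the bound is `≥ 2^{n^{2/13}/8}` for large `n`, `thm54_large`, closing
arithmetic `thm54_bound_ge` in logarithms), and Prop. 5.1 = 1.11 (`M_n^f` is a submatrix of the slack
matrix of `CORR_n`, `HasPsdFactorization.patternMatrix_of_corrSlack` of `PatternMatrixPsdRank.lean`);
`α = min(1/8, 1/(N₀+1))`, and for `n ≤ N₀` the bound only excludes sizes `r ≤ 1`, which are excluded
directly for every `n ≥ 1` (`corrSlack_not_hasPsdFactorization_le_one`: the rows of `0 ≤ 1` and
`x_1² ≤ 1`).  With this file the tree's Lee–Raghavendra–Steurer layer (Thm 1.1, Cor 1.2 (cut), Thm 1.5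
(printed-proof form), Thm 1.6, Thm 6.4) rests on the single named fact `LeeRaghavendraSteurer2015_thm38`
(plus `Schoenebeck2008_maxThreeSatSos` for Max 3-Sat); the cut-polytope corollary is recorded as
`LeeRaghavendraSteurer2015_cor12_cut_of_thm38` (via `CutTspStabPsdRank.lean`'s De Simone step).

Sources: J. R. Lee, P. Raghavendra, D. Steurer, STOC 2015 [LeeRaghavendraSteurer2015], held text
`paper:arxiv-1411.6317`, Thm 5.3 (p. 22–23), eq. (5.1), Thm 5.4 and its proof (p. 23), Thm 1.1 (p. 3);
D. Grigoriev, comput. complexity 10 (2001) [Grigoriev2001] for the functional.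
-/

noncomputable section

open Finset MvPolynomial
open scoped Nat
open Literature.Computability.Complexity (knapsackMoment)
open Literature.Computability.Complexity.Knapsack (functional functional_monomial functional_one
  functional_mul_self_nonneg functional_knapsack_mul)

namespace Literature.Combinatorics.Optimization

variable {m : ℕ}

/-! ### The support set of a cube point; the cube as the Boolean lattice -/

/-- The set `{i | x_i = 1}` of a vertex `x ∈ {0,1}^m`. [cite: LeeRaghavendraSteurer2015, Thm 5.3 proof (p. 22: "|x| denote its hamming weight")] -/
def trueSet (x : Fin m → Bool) : Finset (Fin m) := univ.filter fun i => x i = true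

/-- Membership in the support set. [cite: LeeRaghavendraSteurer2015, Thm 5.3 proof (p. 22)] -/
@[simp] theorem mem_trueSet (x : Fin m → Bool) (i : Fin m) : i ∈ trueSet x ↔ x i = true := by
  simp [trueSet]

/-- `{0,1}^m ≃` subsets of `[m]` (plumbing for reindexing sums over the cube). [folklore] -/
private def boolFinsetEquiv (m : ℕ) : (Fin m → Bool) ≃ Finset (Fin m) where
  toFun x := trueSet x
  invFun U := fun i => decide (i ∈ U)
  left_inv x := by funext i; simp
  right_inv U := by ext i; simp

/-- A monomial evaluated at a cube point is the indicator of "`supp α ⊆ supp x`".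
[cite: LeeRaghavendraSteurer2015, Thm 5.3 proof (p. 22: "consider any monomial x^S = ∏_{i∈S} x_i")] -/
theorem prod_cubePoint_pow_eq_indicator (α : Fin m →₀ ℕ) (x : Fin m → Bool) :
    (∏ i ∈ α.support, cubePoint x i ^ α i) = if α.support ⊆ trueSet x then (1 : ℝ) else 0 := by
  classical
  split_ifs with h
  · refine prod_eq_one fun i hi => ?_
    have hx : x i = true := by simpa using h hi
    simp [cubePoint, hx]
  · obtain ⟨i, hi, hix⟩ := not_subset.1 h
    have hx : x i = false := by simpa using hix
    refine prod_eq_zero hi ?_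
    have hαi : α i ≠ 0 := Finsupp.mem_support_iff.1 hi
    simp [cubePoint, hx, hαi]

/-! ### The pseudo-density, by Möbius inversion of Grigoriev's moments -/

/-- **The knapsack pseudo-density** on `{0,1}^m` with parameter `r` (LRS: `r = m/2`): the unique
function with monomial moments `E_x D(x) x^S = 𝒢(X^S) = B_{|S|}(r) = ∏_{j<|S|} (r−j)/(m−j)`, written by
Möbius inversion over the Boolean lattice, `D(x) = 2^m Σ_{T ⊇ supp x} (−1)^{|T|−|x|} B_{|T|}(r)`.
(LRS write the same function in closed form `2^m c_{|x|}(m/2)/binom(m,|x|)` via Lagrange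
interpolation.) [cite: LeeRaghavendraSteurer2015, Thm 5.3 and its proof (p. 22)] -/
def knapsackDensity (m : ℕ) (r : ℝ) (x : Fin m → Bool) : ℝ :=
  2 ^ m * ∑ T : Finset (Fin m),
    if trueSet x ⊆ T then (-1 : ℝ) ^ (T.card - (trueSet x).card) * knapsackMoment m r T.card else 0

/-- Möbius inversion on an interval of the Boolean lattice:
`Σ_{S ⊆ U ⊆ T} (−1)^{|T∖U|} = [T = S]`. [folklore] -/
private theorem sum_ite_subset_subset_neg_one_pow (S T : Finset (Fin m)) :
    ∑ U : Finset (Fin m), (if S ⊆ U ∧ U ⊆ T then (-1 : ℝ) ^ (T.card - U.card) else 0) =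
      if T = S then 1 else 0 := by
  classical
  by_cases hST : S ⊆ T
  · rw [← Finset.sum_filter]
    have h1 : ∑ U ∈ univ.filter (fun U => S ⊆ U ∧ U ⊆ T), (-1 : ℝ) ^ (T.card - U.card) =
        ∑ W ∈ (T \ S).powerset, (-1 : ℝ) ^ W.card := by
      refine Finset.sum_nbij' (fun U => T \ U) (fun W => T \ W) ?_ ?_ ?_ ?_ ?_
      · intro U hU
        simp only [mem_filter, mem_univ, true_and] at hU
        rw [mem_powerset]
        exact sdiff_subset_sdiff (subset_refl _) hU.1
      · intro W hW
        rw [mem_powerset] at hW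
        simp only [mem_filter, mem_univ, true_and]
        refine ⟨fun i hi => ?_, sdiff_subset⟩
        rw [mem_sdiff]
        exact ⟨hST hi, fun hiW => (mem_sdiff.1 (hW hiW)).2 hi⟩
      · intro U hU
        simp only [mem_filter, mem_univ, true_and] at hU
        rw [sdiff_sdiff_right_self, inf_eq_inter, inter_eq_right.2 hU.2]
      · intro W hW
        rw [mem_powerset] at hW
        rw [sdiff_sdiff_right_self, inf_eq_inter, inter_eq_right.2 (hW.trans sdiff_subset)]
      · intro U hU
        simp only [mem_filter, mem_univ, true_and] at hU
        rw [card_sdiff_of_subset hU.2]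
    rw [h1]
    have h2 := Finset.sum_pow_mul_eq_add_pow (-1 : ℝ) 1 (T \ S)
    simp only [one_pow, mul_one] at h2
    rw [h2, show (-1 : ℝ) + 1 = 0 by norm_num]
    by_cases hTS : T = S
    · subst hTS; simp
    · rw [if_neg hTS, zero_pow]
      rw [ne_eq, card_eq_zero, sdiff_eq_empty_iff_subset]
      exact fun h => hTS (subset_antisymm h hST)
  · have h0 : ∀ U : Finset (Fin m), ¬ (S ⊆ U ∧ U ⊆ T) := fun U h => hST (h.1.trans h.2)
    simp only [h0, if_false, sum_const_zero]
    rw [if_neg]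
    rintro rfl
    exact hST subset_rfl

/-- **The monomial moments of `D`:** `E_x D(x) x^S = B_{|S|}(r)` (`= 𝒢(X^S)`), by Möbius inversion.
[cite: LeeRaghavendraSteurer2015, Thm 5.3 proof (p. 22: "E_x D(x) x^S = … = 𝒢(X^S)")] -/
theorem cubeExpect_knapsackDensity_mul_indicator (r : ℝ) (S : Finset (Fin m)) :
    cubeExpect (fun x => knapsackDensity m r x * if S ⊆ trueSet x then 1 else 0) =
      knapsackMoment m r S.card := by
  classical
  unfold cubeExpect
  have hre : ∑ x : Fin m → Bool, knapsackDensity m r x * (if S ⊆ trueSet x then (1 : ℝ) else 0) =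
      ∑ U : Finset (Fin m), 2 ^ m * ((if S ⊆ U then (1 : ℝ) else 0) *
        ∑ T : Finset (Fin m),
          if U ⊆ T then (-1 : ℝ) ^ (T.card - U.card) * knapsackMoment m r T.card else 0) := by
    refine Fintype.sum_equiv (boolFinsetEquiv m) _ _ fun x => ?_
    rw [show (boolFinsetEquiv m) x = trueSet x from rfl]
    unfold knapsackDensity
    ring
  rw [hre, ← mul_sum, mul_div_cancel_left₀ _ (by positivity)]
  have hU : ∀ U : Finset (Fin m), (if S ⊆ U then (1 : ℝ) else 0) *
      (∑ T : Finset (Fin m),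
        if U ⊆ T then (-1 : ℝ) ^ (T.card - U.card) * knapsackMoment m r T.card else 0) =
      ∑ T : Finset (Fin m), knapsackMoment m r T.card *
        (if S ⊆ U ∧ U ⊆ T then (-1 : ℝ) ^ (T.card - U.card) else 0) := by
    intro U
    rw [mul_sum]
    refine sum_congr rfl fun T _ => ?_
    by_cases h1 : S ⊆ U <;> by_cases h2 : U ⊆ T <;> simp [h1, h2, mul_comm]
  simp_rw [hU]
  rw [sum_comm]
  simp_rw [← mul_sum, sum_ite_subset_subset_neg_one_pow, mul_ite, mul_one, mul_zero]
  simp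

/-- `E_x` of a finite sum of functions. [cite: LeeRaghavendraSteurer2015, §2] -/
theorem cubeExpect_finset_sum {ι : Type*} (s : Finset ι) (F : ι → (Fin m → Bool) → ℝ) :
    cubeExpect (fun x => ∑ i ∈ s, F i x) = ∑ i ∈ s, cubeExpect (F i) := by
  unfold cubeExpect
  rw [Finset.sum_comm, Finset.sum_div]

/-- **`E_x D(x) P(x) = 𝒢(P)` for every real polynomial `P`** (evaluated at the 0/1 point of `x`):
by linearity from the monomial moments, a monomial `X^α` reading as the indicator of
`supp α ⊆ supp x` on the cube and `𝒢(c X^α) = c B_{|supp α|}` (`functional_monomial`).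
[cite: LeeRaghavendraSteurer2015, Thm 5.3 proof (p. 22: "E_x D(x) p(x) = 𝒢(p(X_1,…,X_m)) for every multilinear polynomial p")] -/
theorem cubeExpect_knapsackDensity_mul_eval (r : ℝ) (P : MvPolynomial (Fin m) ℝ) :
    cubeExpect (fun x => knapsackDensity m r x * MvPolynomial.eval (cubePoint x) P) =
      functional m r P := by
  classical
  have hexp : ∀ x : Fin m → Bool, MvPolynomial.eval (cubePoint x) P =
      ∑ α ∈ P.support, P.coeff α * (if α.support ⊆ trueSet x then (1 : ℝ) else 0) := by
    intro x
    rw [MvPolynomial.eval_eq]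
    exact sum_congr rfl fun α _ => by rw [prod_cubePoint_pow_eq_indicator]
  simp_rw [hexp, mul_sum]
  rw [cubeExpect_finset_sum]
  have hrhs : functional m r P = ∑ α ∈ P.support, P.coeff α * knapsackMoment m r α.support.card := by
    conv_lhs => rw [P.as_sum]
    rw [map_sum]
    exact sum_congr rfl fun α _ => functional_monomial r α _
  rw [hrhs]
  refine sum_congr rfl fun α _ => ?_
  have hfun : (fun x => knapsackDensity m r x *
      (P.coeff α * if α.support ⊆ trueSet x then (1 : ℝ) else 0)) =
      fun x => P.coeff α * (knapsackDensity m r x * if α.support ⊆ trueSet x then (1 : ℝ) else 0) := by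
    funext x; ring
  rw [hfun, cubeExpect_const_mul, cubeExpect_knapsackDensity_mul_indicator]

/-- `E_x D(x) = 𝒢(1) = 1`. [cite: LeeRaghavendraSteurer2015, Thm 5.3 (p. 22)] -/
theorem cubeExpect_knapsackDensity (r : ℝ) : cubeExpect (knapsackDensity m r) = 1 := by
  have h := cubeExpect_knapsackDensity_mul_eval r (1 : MvPolynomial (Fin m) ℝ)
  simp only [map_one, mul_one] at h
  rw [functional_one] at h
  exact h

/-- **`D` is a degree-`d` pseudo-density for every `d ≤ m`** (`r = m/2`): `E D = 1` and
`E D g² = 𝒢(P²) ≥ 0` for `g` of degree `≤ d/2` (`P` a representing polynomial), by Grigoriev's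
positivity `𝒢(q²) ≥ 0` for `deg q ≤ l`, `2l ≤ m`, `l − 1 < m/2 < m − l + 1`.
[cite: LeeRaghavendraSteurer2015, Thm 5.3 (p. 22: "a degree-m pseudo-density")]
[cite: Grigoriev2001, Lemma 1.4 (PDF p. 8)] -/
theorem isPseudoDensity_knapsackDensity {d : ℕ} (hd : d ≤ m) :
    IsPseudoDensity d (knapsackDensity m ((m : ℝ) / 2)) := by
  refine ⟨cubeExpect_knapsackDensity _, fun g hg => ?_⟩
  obtain ⟨P, hP, hPg⟩ := hg
  have h := cubeExpect_knapsackDensity_mul_eval ((m : ℝ) / 2) (P * P)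
  have heq : (fun x => knapsackDensity m ((m : ℝ) / 2) x * g x ^ 2) =
      fun x => knapsackDensity m ((m : ℝ) / 2) x * MvPolynomial.eval (cubePoint x) (P * P) := by
    funext x; rw [map_mul, hPg x, sq]
  rw [heq, h]
  have h1 : (((d / 2 : ℕ) : ℝ)) * 2 ≤ d := by exact_mod_cast (by omega : d / 2 * 2 ≤ d)
  have h2 : (d : ℝ) ≤ m := by exact_mod_cast hd
  exact functional_mul_self_nonneg (l := d / 2) (by omega) (by linarith) (by linarith) hP

/-- **`E_x D(x) (Σ_i x_i − m/2)² = 0`** (`m ≥ 2`): `= 𝒢((Σ X_i − m/2)·(Σ X_i − m/2)) = 0` by Grigoriev's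
Lemma 1.3 (`𝒢((Σ X_i − r) g) = 0` for `deg g < m`).
[cite: LeeRaghavendraSteurer2015, Thm 5.3 (p. 22)] [cite: Grigoriev2001, Lemma 1.3 (PDF p. 8)] -/
theorem cubeExpect_knapsackDensity_mul_sq (hm : 2 ≤ m) :
    cubeExpect (fun x => knapsackDensity m ((m : ℝ) / 2) x *
      ((∑ i, cubePoint x i) - (m : ℝ) / 2) ^ 2) = 0 := by
  set q : MvPolynomial (Fin m) ℝ := (∑ j : Fin m, X j) - C ((m : ℝ) / 2) with hq
  have h := cubeExpect_knapsackDensity_mul_eval ((m : ℝ) / 2) (q * q)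
  have heq : (fun x => knapsackDensity m ((m : ℝ) / 2) x * ((∑ i, cubePoint x i) - (m : ℝ) / 2) ^ 2) =
      fun x => knapsackDensity m ((m : ℝ) / 2) x * MvPolynomial.eval (cubePoint x) (q * q) := by
    funext x
    rw [map_mul, hq, map_sub, map_sum, MvPolynomial.eval_C, sq]
    simp only [MvPolynomial.eval_X]
  rw [heq, h, hq]
  apply functional_knapsack_mul
  calc ((∑ j : Fin m, X j) - C ((m : ℝ) / 2) : MvPolynomial (Fin m) ℝ).totalDegree ≤ 1 := by
        refine (totalDegree_sub _ _).trans (max_le ?_ (by simp))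
        exact (totalDegree_finsetSum _ _).trans (Finset.sup_le fun j _ => (totalDegree_X j).le)
    _ < m := by omega

/-! ### The nonnegative quadratic `f` of eq. (5.1) and `E_x D(x) f(x) = −1/(4m²)` -/

/-- **`f(x) = m^{-2}((Σ_i x_i − m/2)² − 1/4)`**, the function of eq. (5.1) whose pattern matrix
`M_n^f` witnesses `rk_psd(CORR_n) ≥ 2^{α n^{2/13}}`. [cite: LeeRaghavendraSteurer2015, eq. (5.1) (p. 23)] -/
def knapsackGap (m : ℕ) (x : Fin m → Bool) : ℝ :=
  (1 / (m : ℝ) ^ 2) * (((∑ i, cubePoint x i) - (m : ℝ) / 2) ^ 2 - 1 / 4)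

/-- **`E_x D(x) f(x) = −1/(4m²)`** (`m ≥ 2`). [cite: LeeRaghavendraSteurer2015, Thm 5.4 proof (p. 23)] -/
theorem cubeExpect_knapsackDensity_mul_knapsackGap (hm : 2 ≤ m) :
    cubeExpect (fun x => knapsackDensity m ((m : ℝ) / 2) x * knapsackGap m x) =
      -(1 / (4 * (m : ℝ) ^ 2)) := by
  have h1 := cubeExpect_knapsackDensity_mul_sq hm
  have h0 := cubeExpect_knapsackDensity (m := m) ((m : ℝ) / 2)
  have heq : (fun x => knapsackDensity m ((m : ℝ) / 2) x * knapsackGap m x) =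
      fun x => (1 / (m : ℝ) ^ 2) * (knapsackDensity m ((m : ℝ) / 2) x *
        ((∑ i, cubePoint x i) - (m : ℝ) / 2) ^ 2) + (-(1 / (4 * (m : ℝ) ^ 2))) *
          knapsackDensity m ((m : ℝ) / 2) x := by
    funext x; unfold knapsackGap; ring
  rw [heq]
  unfold cubeExpect at h1 h0 ⊢
  rw [Finset.sum_add_distrib, ← Finset.mul_sum, ← Finset.mul_sum, add_div, mul_div_assoc,
    mul_div_assoc, h1, h0]
  ring

/-- The sum of the 0/1 coordinates is a natural number (the Hamming weight).
[cite: LeeRaghavendraSteurer2015, Thm 5.3 proof (p. 22: "|x| denote its hamming weight")] -/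
theorem sum_cubePoint_eq_card (x : Fin m → Bool) : ∑ i, cubePoint x i = ((trueSet x).card : ℝ) := by
  classical
  unfold cubePoint trueSet
  rw [Finset.card_filter]
  push_cast
  rfl

/-- **For odd `m`, `0 ≤ f ≤ 1` on the cube:** `(w − m/2)² − 1/4 = (w − k)(w − k − 1) ≥ 0` for the
integer weight `w` (`m = 2k+1`), and `(w − m/2)² ≤ m²/4`.
[cite: LeeRaghavendraSteurer2015, Thm 5.4 proof (p. 23: "f : {0,1}^m → ℝ_{≥0}")] -/
theorem knapsackGap_mem_Icc (hm : Odd m) (x : Fin m → Bool) :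
    0 ≤ knapsackGap m x ∧ knapsackGap m x ≤ 1 := by
  obtain ⟨k, hk⟩ := hm
  have hm1 : (1 : ℝ) ≤ m := by exact_mod_cast (by omega : 1 ≤ m)
  have hmk : (m : ℝ) = 2 * k + 1 := by exact_mod_cast hk
  rw [knapsackGap, sum_cubePoint_eq_card]
  set w : ℕ := (trueSet x).card with hw
  have hwm : w ≤ m := by
    rw [hw]; exact (card_le_univ _).trans (by simp)
  have hwR : (w : ℝ) ≤ m := by exact_mod_cast hwm
  have hw0 : (0 : ℝ) ≤ w := Nat.cast_nonneg w
  -- `(w − m/2)² − 1/4 = (w − k)(w − k − 1)`, a product of consecutive integers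
  have hprod : ((w : ℝ) - (m : ℝ) / 2) ^ 2 - 1 / 4 = ((w : ℝ) - k) * ((w : ℝ) - k - 1) := by
    rw [hmk]; ring
  have hnn : 0 ≤ ((w : ℝ) - k) * ((w : ℝ) - k - 1) := by
    rcases le_or_gt w k with h | h
    · have h1 : (w : ℝ) ≤ k := by exact_mod_cast h
      nlinarith
    · have h1 : (k : ℝ) + 1 ≤ w := by exact_mod_cast h
      nlinarith
  constructor
  · rw [hprod]; positivity
  · rw [hprod]
    have hsq : ((w : ℝ) - k) * ((w : ℝ) - k - 1) ≤ (m : ℝ) ^ 2 := by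
      rw [← hprod]; nlinarith
    calc 1 / (m : ℝ) ^ 2 * (((w : ℝ) - k) * ((w : ℝ) - k - 1)) ≤ 1 / (m : ℝ) ^ 2 * (m : ℝ) ^ 2 :=
          mul_le_mul_of_nonneg_left hsq (by positivity)
      _ = 1 := by field_simp

/-- Coordinates of a 0/1 point are idempotent: `x_i² = x_i`. [cite: LeeRaghavendraSteurer2015, Prop. 5.1 proof (p. 22)] -/
theorem cubePoint_mul_self (x : Fin m → Bool) (i : Fin m) :
    cubePoint x i * cubePoint x i = cubePoint x i := by
  unfold cubePoint; split_ifs <;> simp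

/-- **`f` is a (nonnegative, for odd `m`) quadratic function on the cube** in the normal form of
Prop. 1.11/5.1: `f(x) = (m² − 1)/(4m²) − Σ_{i,j} A_{ij} x_i x_j` with `A_{ij} = (m δ_{ij} − 1)/m²`
(using `x_i² = x_i`).  So `M_n^f` is a submatrix of a slack matrix of `CORR_n` (Prop. 5.1,
`HasPsdFactorization.patternMatrix_of_corrSlack`). [cite: LeeRaghavendraSteurer2015, Prop. 5.1 and eq. (5.1) (p. 22–23)] -/
theorem isCubeQuadratic_knapsackGap (hm : 1 ≤ m) : IsCubeQuadratic (knapsackGap m) := by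
  classical
  have hm0 : (m : ℝ) ≠ 0 := by exact_mod_cast (by omega : m ≠ 0)
  refine ⟨fun i j => ((if i = j then (m : ℝ) else 0) - 1) / (m : ℝ) ^ 2,
    ((m : ℝ) ^ 2 - 1) / (4 * (m : ℝ) ^ 2), fun x => ?_⟩
  -- expand `(Σ p_i − m/2)²` with `p_i² = p_i`
  have hsq : (∑ i, cubePoint x i) ^ 2 = ∑ i, ∑ j, cubePoint x i * cubePoint x j := by
    rw [sq, Finset.sum_mul_sum]
  have hdiag : ∑ i, ∑ j, (if i = j then (m : ℝ) else 0) * (cubePoint x i * cubePoint x j) =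
      (m : ℝ) * ∑ i, cubePoint x i := by
    rw [Finset.mul_sum]
    refine sum_congr rfl fun i _ => ?_
    rw [Finset.sum_eq_single i (fun j _ hji => by rw [if_neg (Ne.symm hji), zero_mul])
      (fun h => absurd (mem_univ i) h), if_pos rfl, cubePoint_mul_self]
  have hsplit : ∑ i, ∑ j, ((if i = j then (m : ℝ) else 0) - 1) / (m : ℝ) ^ 2 *
      (cubePoint x i * cubePoint x j) =
      ((m : ℝ) * ∑ i, cubePoint x i - ∑ i, ∑ j, cubePoint x i * cubePoint x j) / (m : ℝ) ^ 2 := by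
    rw [← hdiag, ← Finset.sum_sub_distrib, Finset.sum_div]
    refine sum_congr rfl fun i _ => ?_
    rw [← Finset.sum_sub_distrib, Finset.sum_div]
    refine sum_congr rfl fun j _ => ?_
    ring
  have hsq' : ((∑ i, cubePoint x i) - (m : ℝ) / 2) ^ 2 =
      ∑ i, ∑ j, cubePoint x i * cubePoint x j - (m : ℝ) * ∑ i, cubePoint x i + (m : ℝ) ^ 2 / 4 := by
    rw [sub_sq, hsq]; ring
  rw [hsplit, knapsackGap, hsq']
  field_simp
  ring

/-- `f(0) = (m² − 1)/(4m²) > 0` for `m ≥ 2`: `f` is not identically zero, `E_x f(x) > 0`.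
[cite: LeeRaghavendraSteurer2015, Thm 5.4 proof (p. 23)] -/
theorem knapsackGap_zero (m : ℕ) :
    knapsackGap m (fun _ => false) = ((m : ℝ) ^ 2 - 1) / (4 * (m : ℝ) ^ 2) := by
  unfold knapsackGap cubePoint
  simp only [Bool.false_eq_true, if_false, Finset.sum_const_zero, zero_sub]
  rcases Nat.eq_zero_or_pos m with h | h
  · subst h; simp
  · have hm0 : (m : ℝ) ≠ 0 := by exact_mod_cast h.ne'
    field_simp
    ring

/-! ### The sup-norm bound `‖D‖_∞ ≤ m` (second part of Thm 5.3), by a finite-difference closed form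

LRS (p. 22–23) bound `‖D‖_∞` through the Lagrange-interpolation closed form
`D(x) = 2^m c_{|x|}(m/2)/binom(m,|x|)`, `|D(x)| = ∏_{a ≠ |x|} |m − 2a| / m!`.  We reach the same closed
form from the Möbius definition: grouping `T ⊇ supp x` by size, `D(x)/2^m = Σ_i (−1)^i binom(m−u,i)
B_{u+i}` (`u = |x|`), `B_{u+i} = B_u · ∏_{b<i} (r−u−b)/(m−u−b)`, `binom(m−u,i) ∏_{b<i} (m−u−b)^{-1} = 1/i!`,
and the finite-difference identity `Σ_{i ≤ M} (−1)^i y(y−1)⋯(y−i+1)/i! = (−1)^M (y−1)⋯(y−M)/M!`;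
for `r = m/2` this gives `|D(x)| · |m − 2u| · m! = ∏_{a=0}^{m} |m − 2a| = (m‼)²` and, for odd `m`,
`(m‼)² ≤ m · m!`, so `|D(x)| ≤ m ≤ m^{3/2}`. -/

/-- `P_{i+1}(y) = y · P_i(y − 1)` for the falling factorials `P_i(y) = ∏_{b<i} (y − b)`. [folklore] -/
private theorem ffR_succ_left (y : ℝ) (i : ℕ) :
    ∏ b ∈ range (i + 1), (y - (b : ℝ)) = y * ∏ b ∈ range i, (y - 1 - (b : ℝ)) := by
  rw [Finset.prod_range_succ']
  simp only [Nat.cast_add, Nat.cast_one, Nat.cast_zero, sub_zero]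
  rw [mul_comm]
  congr 1
  exact prod_congr rfl fun b _ => by ring

/-- `Σ_{i ≤ M} (−1)^i P_i(y)/i! = (−1)^M P_M(y−1)/M!` for the falling factorials `P_i`
(partial alternating sums of generalised binomial coefficients). [folklore] -/
private theorem alternating_sum_ffR_div_factorial (y : ℝ) (M : ℕ) :
    ∑ i ∈ range (M + 1), (-1 : ℝ) ^ i * (∏ b ∈ range i, (y - (b : ℝ))) / (i.factorial : ℝ) =
      (-1) ^ M * (∏ b ∈ range M, (y - 1 - (b : ℝ))) / (M.factorial : ℝ) := by
  induction M with
  | zero => simp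
  | succ M ih =>
    rw [Finset.sum_range_succ, ih]
    have h1 : ∏ b ∈ range (M + 1), (y - (b : ℝ)) =
        ∏ b ∈ range (M + 1), (y - 1 - (b : ℝ)) + (M + 1) * ∏ b ∈ range M, (y - 1 - (b : ℝ)) := by
      rw [ffR_succ_left, Finset.prod_range_succ]
      ring
    rw [h1, Nat.factorial_succ]
    push_cast
    have hM : ((M.factorial : ℕ) : ℝ) ≠ 0 := by positivity
    field_simp
    ring

/-- `B_{u+i}(r) = B_u(r) · ∏_{b<i} (r−u−b)/(m−u−b)`. [cite: Grigoriev2001, §1 (definition of B, PDF p. 8)] -/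
private theorem knapsackMoment_add (m : ℕ) (r : ℝ) (u i : ℕ) :
    knapsackMoment m r (u + i) =
      knapsackMoment m r u * ∏ b ∈ range i, (r - ((u : ℝ) + b)) / ((m : ℝ) - ((u : ℝ) + b)) := by
  unfold knapsackMoment
  rw [Finset.prod_range_add]
  push_cast
  rfl

/-- `binom(N,i) · ∏_{b<i} (y−b)/(N−b) = P_i(y)/i!` for `i ≤ N`. [folklore] -/
private theorem choose_mul_prod_div (N i : ℕ) (hi : i ≤ N) (y : ℝ) :
    (N.choose i : ℝ) * ∏ b ∈ range i, (y - b) / ((N : ℝ) - b) =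
      (∏ b ∈ range i, (y - (b : ℝ))) / (i.factorial : ℝ) := by
  rw [Finset.prod_div_distrib]
  have hden : ∏ b ∈ range i, ((N : ℝ) - b) = (N.descFactorial i : ℝ) := by
    rw [Nat.descFactorial_eq_prod_range, Nat.cast_prod]
    refine prod_congr rfl fun b hb => ?_
    rw [Nat.cast_sub ((mem_range.1 hb).le.trans hi)]
  rw [hden, Nat.descFactorial_eq_factorial_mul_choose, Nat.cast_mul]
  have hc : (N.choose i : ℝ) ≠ 0 := by exact_mod_cast (Nat.choose_pos hi).ne'
  have hf : (i.factorial : ℝ) ≠ 0 := by positivity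
  field_simp

/-- **Closed form of `D` at a vertex** with `u = |x|` ones:
`D(x) = 2^m · B_u(r) · (−1)^{m−u} P_{m−u}(r−u−1)/(m−u)!`.
[cite: LeeRaghavendraSteurer2015, Thm 5.3 proof (p. 22–23: the closed form of D)] -/
theorem knapsackDensity_eq_closedForm (r : ℝ) (x : Fin m → Bool) :
    knapsackDensity m r x = 2 ^ m * (knapsackMoment m r (trueSet x).card *
      ((-1) ^ (m - (trueSet x).card) * (∏ b ∈ range (m - (trueSet x).card),
          (r - (trueSet x).card - 1 - b)) / ((m - (trueSet x).card).factorial : ℝ))) := by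
  classical
  set U := trueSet x with hU
  set u := U.card with hu
  have hum : u ≤ m := by rw [hu]; exact (card_le_univ U).trans (by simp)
  unfold knapsackDensity
  congr 1
  -- group the supersets `T ⊇ U` by `W = T \ U ⊆ Uᶜ`
  have hstep1 : ∑ T : Finset (Fin m),
      (if U ⊆ T then (-1 : ℝ) ^ (T.card - u) * knapsackMoment m r T.card else 0) =
      ∑ W ∈ (univ \ U).powerset, (-1 : ℝ) ^ W.card * knapsackMoment m r (u + W.card) := by
    rw [← Finset.sum_filter]
    refine Finset.sum_nbij' (fun T => T \ U) (fun W => U ∪ W) ?_ ?_ ?_ ?_ ?_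
    · intro T _; rw [mem_powerset]; exact sdiff_subset_sdiff (subset_univ _) (subset_refl _)
    · intro W _; simp only [mem_filter, mem_univ, true_and]; exact subset_union_left
    · intro T hT
      simp only [mem_filter, mem_univ, true_and] at hT
      exact union_sdiff_of_subset hT
    · intro W hW
      rw [mem_powerset] at hW
      rw [union_sdiff_left, Finset.sdiff_eq_self_iff_disjoint]
      exact Disjoint.mono_left hW disjoint_sdiff_self_left
    · intro T hT
      simp only [mem_filter, mem_univ, true_and] at hT
      rw [card_sdiff_of_subset hT, Nat.add_sub_cancel' (card_le_card hT)]
  rw [hstep1, Finset.sum_powerset_apply_card (fun i => (-1 : ℝ) ^ i * knapsackMoment m r (u + i))]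
  have hcard : (univ \ U).card = m - u := by
    rw [card_sdiff_of_subset (subset_univ _)]; simp [hu]
  rw [hcard]
  simp_rw [nsmul_eq_mul]
  have hsub : ∀ b : ℕ, (r - ((u : ℝ) + b)) / ((m : ℝ) - ((u : ℝ) + b)) =
      ((r - u) - b) / (((m - u : ℕ) : ℝ) - b) := by
    intro b; rw [Nat.cast_sub hum]; congr 1 <;> ring
  have hfac : ∀ i ∈ range (m - u + 1),
      ((m - u).choose i : ℝ) * ((-1 : ℝ) ^ i * knapsackMoment m r (u + i)) =
      knapsackMoment m r u * ((-1 : ℝ) ^ i * (∏ b ∈ range i, ((r - u) - (b : ℝ))) / (i.factorial : ℝ)) := by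
    intro i hi
    have hi' : i ≤ m - u := Nat.lt_succ_iff.1 (mem_range.1 hi)
    rw [knapsackMoment_add, Finset.prod_congr rfl fun b _ => hsub b]
    have hc := choose_mul_prod_div (m - u) i hi' (r - u)
    linear_combination ((-1 : ℝ) ^ i * knapsackMoment m r u) * hc
  rw [Finset.sum_congr rfl hfac, ← Finset.mul_sum, alternating_sum_ffR_div_factorial]

/-- `∏_{a=0}^{m} (m − 2a) = 2^m (m − 2u) · ∏_{a<u} (m/2 − a) · ∏_{b < m−u} (m/2 − u − 1 − b)` (`u ≤ m`).
[folklore] -/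
private theorem prod_range_sub_two_mul (m u : ℕ) (hum : u ≤ m) :
    ∏ a ∈ range (m + 1), ((m : ℝ) - 2 * a) =
      2 ^ m * ((m : ℝ) - 2 * u) * (∏ a ∈ range u, ((m : ℝ) / 2 - a)) *
        ∏ b ∈ range (m - u), ((m : ℝ) / 2 - u - 1 - b) := by
  have hsplit : m + 1 = u + (m - u + 1) := by omega
  rw [hsplit, Finset.prod_range_add, Finset.prod_range_succ']
  have h1 : ∏ a ∈ range u, ((m : ℝ) - 2 * a) = 2 ^ u * ∏ a ∈ range u, ((m : ℝ) / 2 - a) := by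
    rw [show (2 : ℝ) ^ u = ∏ _a ∈ range u, (2 : ℝ) by simp, ← Finset.prod_mul_distrib]
    exact prod_congr rfl fun a _ => by ring
  have h2 : ∏ b ∈ range (m - u), ((m : ℝ) - 2 * ((u + (b + 1) : ℕ) : ℝ)) =
      2 ^ (m - u) * ∏ b ∈ range (m - u), ((m : ℝ) / 2 - u - 1 - b) := by
    rw [show (2 : ℝ) ^ (m - u) = ∏ _b ∈ range (m - u), (2 : ℝ) by simp, ← Finset.prod_mul_distrib]
    exact prod_congr rfl fun b _ => by push_cast; ring
  rw [h1, h2]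
  have h2m : (2 : ℝ) ^ m = 2 ^ u * 2 ^ (m - u) := by rw [← pow_add, Nat.add_sub_cancel' hum]
  rw [h2m]
  push_cast
  ring

/-- **The closed form for `r = m/2`:** `D(x) · (m − 2u) · (−1)^{m−u} · m! = ∏_{a=0}^{m} (m − 2a)`,
`u = |x|`. [cite: LeeRaghavendraSteurer2015, Thm 5.3 proof (p. 23: "|D(x)| = |2^m c_w(m/2)/binom(m,w)| = …")] -/
theorem knapsackDensity_mul_eq_prod (x : Fin m → Bool) :
    knapsackDensity m ((m : ℝ) / 2) x * ((m : ℝ) - 2 * (trueSet x).card) *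
        (-1) ^ (m - (trueSet x).card) * (m.factorial : ℝ) =
      ∏ a ∈ range (m + 1), ((m : ℝ) - 2 * a) := by
  set u := (trueSet x).card with hu
  have hum : u ≤ m := by rw [hu]; exact (card_le_univ _).trans (by simp)
  rw [knapsackDensity_eq_closedForm, ← hu, prod_range_sub_two_mul m u hum]
  -- `B_u(m/2) = ∏_{a<u} (m/2 − a) / m.descFactorial u` and `m.descFactorial u · (m−u)! = m!`
  have hmom : knapsackMoment m ((m : ℝ) / 2) u * (m.descFactorial u : ℝ) =
      ∏ a ∈ range u, ((m : ℝ) / 2 - a) := by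
    unfold knapsackMoment
    rw [Finset.prod_div_distrib, Nat.descFactorial_eq_prod_range, Nat.cast_prod]
    have hden : ∏ b ∈ range u, (((m - b : ℕ) : ℝ)) = ∏ b ∈ range u, ((m : ℝ) - b) :=
      prod_congr rfl fun b hb => by rw [Nat.cast_sub ((mem_range.1 hb).le.trans hum)]
    rw [hden, div_mul_cancel₀]
    exact Finset.prod_ne_zero_iff.2 fun b hb => by
      have : (b : ℝ) < m := by exact_mod_cast (mem_range.1 hb).trans_le hum
      linarith
  have hfact : (m.factorial : ℝ) = ((m - u).factorial : ℝ) * (m.descFactorial u : ℝ) := by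
    exact_mod_cast (Nat.factorial_mul_descFactorial hum).symm
  obtain ⟨s, hs, hs2⟩ : ∃ s : ℝ, (-1 : ℝ) ^ (m - u) = s ∧ s * s = 1 :=
    ⟨_, rfl, by rw [← pow_add, ← two_mul, pow_mul]; simp⟩
  have hf0 : ((m - u).factorial : ℝ) ≠ 0 := by positivity
  have hinv : (((m - u).factorial : ℝ))⁻¹ * ((m - u).factorial : ℝ) = 1 := inv_mul_cancel₀ hf0
  rw [hfact, ← hmom, hs]
  set F := ∏ b ∈ range (m - u), ((m : ℝ) / 2 - u - 1 - b) with hF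
  set g := knapsackMoment m ((m : ℝ) / 2) u with hg
  rw [div_eq_mul_inv]
  linear_combination (2 ^ m * g * F * ((m : ℝ) - 2 * u) *
      (m.descFactorial u : ℝ) * (((m - u).factorial : ℝ))⁻¹ * ((m - u).factorial : ℝ)) * hs2 +
    (2 ^ m * g * F * ((m : ℝ) - 2 * u) * (m.descFactorial u : ℝ)) * hinv

/-- `∏_{b<k+1} (2b+1) = (2k+1)‼`. [folklore] -/
private theorem prod_range_two_mul_add_one (k : ℕ) : ∏ b ∈ range (k + 1), (2 * b + 1) = (2 * k + 1)‼ := by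
  induction k with
  | zero => simp
  | succ k ih =>
    rw [Finset.prod_range_succ, ih, show 2 * (k + 1) + 1 = 2 * k + 1 + 2 by ring,
      Nat.doubleFactorial_add_two]
    ring

/-- `∏_{a=0}^{m} |m − 2a| = (m‼)²` for odd `m`. [folklore] -/
private theorem prod_abs_sub_two_mul (k : ℕ) :
    ∏ a ∈ range (2 * k + 1 + 1), |((2 * k + 1 : ℕ) : ℝ) - 2 * a| = (((2 * k + 1)‼ ^ 2 : ℕ) : ℝ) := by
  rw [show 2 * k + 1 + 1 = (k + 1) + (k + 1) by ring, Finset.prod_range_add]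
  have h1 : ∏ a ∈ range (k + 1), |((2 * k + 1 : ℕ) : ℝ) - 2 * a| =
      ((∏ b ∈ range (k + 1), (2 * b + 1) : ℕ) : ℝ) := by
    rw [← Finset.prod_range_reflect (fun b => 2 * b + 1) (k + 1), Nat.cast_prod]
    refine prod_congr rfl fun a ha => ?_
    have hak : a ≤ k := Nat.lt_succ_iff.1 (mem_range.1 ha)
    rw [show k + 1 - 1 - a = k - a by omega]
    have : ((2 * (k - a) + 1 : ℕ) : ℝ) = ((2 * k + 1 : ℕ) : ℝ) - 2 * a := by
      rw [Nat.cast_add, Nat.cast_mul, Nat.cast_sub hak]; push_cast; ring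
    rw [this, abs_of_nonneg]
    have : (a : ℝ) ≤ k := by exact_mod_cast hak
    push_cast; linarith
  have h2 : ∏ b ∈ range (k + 1), |((2 * k + 1 : ℕ) : ℝ) - 2 * (((k + 1) + b : ℕ) : ℝ)| =
      ((∏ b ∈ range (k + 1), (2 * b + 1) : ℕ) : ℝ) := by
    rw [Nat.cast_prod]
    refine prod_congr rfl fun b _ => ?_
    rw [show ((2 * k + 1 : ℕ) : ℝ) - 2 * (((k + 1) + b : ℕ) : ℝ) = -(((2 * b + 1 : ℕ) : ℝ)) by
      push_cast; ring, abs_neg, abs_of_nonneg (by positivity)]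
  rw [h1, h2, prod_range_two_mul_add_one]
  push_cast
  ring

/-- `n‼ ≤ (n+1)‼`. [folklore] -/
private theorem doubleFactorial_le_succ : ∀ n : ℕ, n‼ ≤ (n + 1)‼
  | 0 => by simp
  | 1 => by simp [Nat.doubleFactorial]
  | n + 2 => by
    rw [Nat.doubleFactorial_add_two, show n + 2 + 1 = (n + 1) + 2 by ring,
      Nat.doubleFactorial_add_two]
    exact Nat.mul_le_mul (by omega) (doubleFactorial_le_succ n)

/-- `(m‼)² ≤ m · m!` for odd `m`. [folklore] -/
private theorem doubleFactorial_sq_le (k : ℕ) :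
    (2 * k + 1)‼ ^ 2 ≤ (2 * k + 1) * (2 * k + 1).factorial := by
  have hmono : Monotone Nat.doubleFactorial := monotone_nat_of_le_succ doubleFactorial_le_succ
  have h1 : (2 * k + 1).factorial = (2 * k + 1)‼ * (2 * k)‼ :=
    Nat.factorial_eq_mul_doubleFactorial (2 * k)
  have h2 : (2 * k + 1)‼ = (2 * k + 1) * (2 * k - 1)‼ := Nat.doubleFactorial_add_one (2 * k)
  have h3 : (2 * k - 1)‼ ≤ (2 * k)‼ := hmono (Nat.sub_le _ _)
  calc (2 * k + 1)‼ ^ 2 = (2 * k + 1)‼ * ((2 * k + 1) * (2 * k - 1)‼) := by rw [sq, ← h2]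
    _ ≤ (2 * k + 1)‼ * ((2 * k + 1) * (2 * k)‼) :=
        Nat.mul_le_mul le_rfl (Nat.mul_le_mul le_rfl h3)
    _ = (2 * k + 1) * (2 * k + 1).factorial := by rw [h1]; ring

/-- **Lee–Raghavendra–Steurer 2015, Thm 5.3, the sup-norm bound (PROVED, in the sharper form
`‖D‖_∞ ≤ m`):** for odd `m`, the knapsack pseudo-density satisfies `|D(x)| ≤ m` for every vertex `x`
(`|D(x)| · |m − 2|x|| · m! = (m‼)² ≤ m · m!` and `|m − 2|x|| ≥ 1`).  The printed bound is
`‖D‖_∞ ≤ m^{3/2}`. [cite: LeeRaghavendraSteurer2015, Thm 5.3 (p. 22: "‖D‖_∞ ≤ m^{3/2}") and its proof (p. 23)] -/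
theorem abs_knapsackDensity_le (hm : Odd m) (x : Fin m → Bool) :
    |knapsackDensity m ((m : ℝ) / 2) x| ≤ m := by
  obtain ⟨k, rfl⟩ := hm
  set u := (trueSet x).card with hu
  set Dx := knapsackDensity (2 * k + 1) (((2 * k + 1 : ℕ) : ℝ) / 2) x with hDx
  have hid := knapsackDensity_mul_eq_prod x
  rw [← hu, ← hDx] at hid
  have habs : |Dx| * |((2 * k + 1 : ℕ) : ℝ) - 2 * u| * ((2 * k + 1).factorial : ℝ) =
      (((2 * k + 1)‼ ^ 2 : ℕ) : ℝ) := by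
    have h := congrArg abs hid
    rw [abs_mul, abs_mul, abs_mul, abs_pow, abs_neg, abs_one, one_pow, mul_one, Nat.abs_cast,
      Finset.abs_prod] at h
    rw [h]
    exact prod_abs_sub_two_mul k
  have hodd : (1 : ℝ) ≤ |((2 * k + 1 : ℕ) : ℝ) - 2 * u| := by
    rcases le_or_gt u k with h | h
    · have h' : (u : ℝ) ≤ k := by exact_mod_cast h
      rw [abs_of_nonneg] <;> · push_cast; linarith
    · have h' : (k : ℝ) + 1 ≤ u := by exact_mod_cast h
      rw [abs_of_neg] <;> · push_cast; linarith
  have hbound : (((2 * k + 1)‼ ^ 2 : ℕ) : ℝ) ≤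
      ((2 * k + 1 : ℕ) : ℝ) * ((2 * k + 1).factorial : ℝ) := by
    exact_mod_cast doubleFactorial_sq_le k
  have hf : (0 : ℝ) < ((2 * k + 1).factorial : ℝ) := by positivity
  rw [← habs] at hbound
  have h1 : |Dx| * |((2 * k + 1 : ℕ) : ℝ) - 2 * u| ≤ ((2 * k + 1 : ℕ) : ℝ) :=
    le_of_mul_le_mul_right hbound hf
  calc |Dx| = |Dx| * 1 := (mul_one _).symm
    _ ≤ |Dx| * |((2 * k + 1 : ℕ) : ℝ) - 2 * u| := mul_le_mul_of_nonneg_left hodd (abs_nonneg _)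
    _ ≤ ((2 * k + 1 : ℕ) : ℝ) := h1

/-- **Lee–Raghavendra–Steurer 2015, Theorem 5.3, assembled (PROVED):** for odd `m ≥ 3` the function
`D = knapsackDensity m (m/2)` is a degree-`m` pseudo-density on `{0,1}^m` with
`E_x D(x)(Σ_i x_i − m/2)² = 0` and `‖D‖_∞ ≤ m^{3/2}` (indeed `≤ m`).
[cite: LeeRaghavendraSteurer2015, Thm 5.3 (p. 22)] -/
theorem LeeRaghavendraSteurer2015_thm53 (hm : Odd m) (hm3 : 3 ≤ m) :
    IsPseudoDensity m (knapsackDensity m ((m : ℝ) / 2)) ∧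
      cubeExpect (fun x => knapsackDensity m ((m : ℝ) / 2) x *
        ((∑ i, cubePoint x i) - (m : ℝ) / 2) ^ 2) = 0 ∧
      ∀ x, |knapsackDensity m ((m : ℝ) / 2) x| ≤ (m : ℝ) ^ ((3 : ℝ) / 2) := by
  refine ⟨isPseudoDensity_knapsackDensity le_rfl, cubeExpect_knapsackDensity_mul_sq (by omega),
    fun x => (abs_knapsackDensity_le hm x).trans ?_⟩
  have h1 : (1 : ℝ) ≤ m := by exact_mod_cast (by omega : 1 ≤ m)
  calc (m : ℝ) = (m : ℝ) ^ (1 : ℝ) := (Real.rpow_one _).symm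
    _ ≤ (m : ℝ) ^ ((3 : ℝ) / 2) := Real.rpow_le_rpow_of_exponent_le h1 (by norm_num)

/-! ### Theorem 5.4 = Theorem 1.1 from Theorem 3.8: `rk_psd(CORR_n) ≥ 2^{α n^{2/13}}` -/

section Thm54

open Filter

/-- Small sizes directly: the full slack matrix of `CORR_n` (`n ≥ 1`) has no psd factorisation of
size `≤ 1` — the rows of the valid inequalities `0 ≤ 1` and `x_1² ≤ 1` at the vertices `0` and `𝟙`
are `(1,1)` and `(1,0)`. [cite: LeeRaghavendraSteurer2015, Thm 1.1 (p. 3) and §1.1 (CORR_n)] -/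
theorem corrSlack_not_hasPsdFactorization_le_one {n : ℕ} (hn : 1 ≤ n) {r : ℕ} (hr : r ≤ 1) :
    ¬ ∃ (U : {cb : Matrix (Fin n) (Fin n) ℝ × ℝ //
              ∀ x : Fin n → ℝ, (∀ i, x i = 0 ∨ x i = 1) →
                ∑ i, ∑ j, cb.1 i j * (x i * x j) ≤ cb.2} → Matrix (Fin r) (Fin r) ℝ)
        (V : {x : Fin n → ℝ // ∀ i, x i = 0 ∨ x i = 1} → Matrix (Fin r) (Fin r) ℝ),
        (∀ cb, (U cb).PosSemidef) ∧ (∀ x, (V x).PosSemidef) ∧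
        ∀ cb x, cb.1.2 - ∑ i, ∑ j, cb.1.1 i j * (x.1 i * x.1 j) = Matrix.trace (U cb * V x) := by
  classical
  rintro ⟨U, V, -, -, hfac⟩
  set i₀ : Fin n := ⟨0, hn⟩ with hi₀
  -- the diagonal unit matrix at `(i₀,i₀)` and its quadratic form
  set E : Matrix (Fin n) (Fin n) ℝ := fun i j => if i = i₀ ∧ j = i₀ then 1 else 0 with hE
  have hEx : ∀ x : Fin n → ℝ, ∑ i, ∑ j, E i j * (x i * x j) = x i₀ * x i₀ := by
    intro x
    rw [Finset.sum_eq_single i₀]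
    · rw [Finset.sum_eq_single i₀]
      · simp [hE]
      · intro j _ hj; simp [hE, hj]
      · simp
    · intro i _ hi
      exact Finset.sum_eq_zero fun j _ => by simp [hE, hi]
    · simp
  -- the two valid inequalities and the two vertices
  let cb₁ : {cb : Matrix (Fin n) (Fin n) ℝ × ℝ //
      ∀ x : Fin n → ℝ, (∀ i, x i = 0 ∨ x i = 1) → ∑ i, ∑ j, cb.1 i j * (x i * x j) ≤ cb.2} :=
    ⟨((0 : Matrix (Fin n) (Fin n) ℝ), 1), fun x _ => by simp⟩
  let cb₂ : {cb : Matrix (Fin n) (Fin n) ℝ × ℝ //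
      ∀ x : Fin n → ℝ, (∀ i, x i = 0 ∨ x i = 1) → ∑ i, ∑ j, cb.1 i j * (x i * x j) ≤ cb.2} :=
    ⟨(E, 1), fun x hx => by
      show ∑ i, ∑ j, E i j * (x i * x j) ≤ 1
      rw [hEx]
      rcases hx i₀ with h | h <;> rw [h] <;> norm_num⟩
  let x₀ : {x : Fin n → ℝ // ∀ i, x i = 0 ∨ x i = 1} := ⟨fun _ => 0, fun _ => Or.inl rfl⟩
  let x₁ : {x : Fin n → ℝ // ∀ i, x i = 0 ∨ x i = 1} := ⟨fun _ => 1, fun _ => Or.inr rfl⟩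
  have h11 : (1 : ℝ) - ∑ i, ∑ j, (0 : Matrix (Fin n) (Fin n) ℝ) i j * (x₁.1 i * x₁.1 j) =
      (U cb₁ * V x₁).trace := hfac cb₁ x₁
  have h20 : (1 : ℝ) - ∑ i, ∑ j, E i j * (x₀.1 i * x₀.1 j) = (U cb₂ * V x₀).trace := hfac cb₂ x₀
  have h21 : (1 : ℝ) - ∑ i, ∑ j, E i j * (x₁.1 i * x₁.1 j) = (U cb₂ * V x₁).trace := hfac cb₂ x₁
  rw [hEx] at h20 h21
  simp only [Matrix.zero_apply, zero_mul, Finset.sum_const_zero, sub_zero] at h11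
  have e0 : x₀.1 i₀ = 0 := rfl
  have e1 : x₁.1 i₀ = 1 := rfl
  rw [e0] at h20
  rw [e1] at h21
  norm_num at h20 h21
  interval_cases r
  · -- `r = 0`: the trace of a `0 × 0` product vanishes
    simp [Matrix.trace] at h11
  · -- `r = 1`: `1 × 1` factors `a, b` with `a₁ b₁ = 1`, `a₂ b₀ = 1`, `a₂ b₁ = 0`
    rw [Matrix.trace_fin_one, Matrix.mul_apply, Fin.sum_univ_one] at h11 h20 h21
    have a11 : U cb₁ 0 0 * V x₁ 0 0 = 1 := by linarith
    have a20 : U cb₂ 0 0 * V x₀ 0 0 = 1 := by linarith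
    have a21 : U cb₂ 0 0 * V x₁ 0 0 = 0 := by linarith
    have key : (U cb₂ 0 0 * V x₁ 0 0) * (U cb₁ 0 0 * V x₀ 0 0) =
        (U cb₂ 0 0 * V x₀ 0 0) * (U cb₁ 0 0 * V x₁ 0 0) := by ring
    rw [a21, a20, a11] at key
    norm_num at key

/-- `E_x f(x) ≥ 2^{-(m+3)}` for odd `m ≥ 3` (the vertex `0` alone contributes `f(0) ≥ 1/8`).
[cite: LeeRaghavendraSteurer2015, Thm 5.4 proof (p. 23)] -/
theorem cubeExpect_knapsackGap_ge (hodd : Odd m) (hm : 3 ≤ m) :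
    (1 : ℝ) / 2 ^ (m + 3) ≤ cubeExpect (knapsackGap m) := by
  have hm2 : (2 : ℝ) ≤ m := by exact_mod_cast (by omega : 2 ≤ m)
  have hf0 : (1 : ℝ) / 8 ≤ knapsackGap m (fun _ => false) := by
    rw [knapsackGap_zero, div_le_div_iff₀ (by norm_num) (by positivity)]
    nlinarith
  have hle : knapsackGap m (fun _ => false) ≤ ∑ x, knapsackGap m x :=
    Finset.single_le_sum (fun x _ => (knapsackGap_mem_Icc hodd x).1) (Finset.mem_univ _)
  unfold cubeExpect
  calc (1 : ℝ) / 2 ^ (m + 3) = (1 / 8) / 2 ^ m := by rw [pow_add]; ring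
    _ ≤ knapsackGap m (fun _ => false) / 2 ^ m := by gcongr
    _ ≤ (∑ x, knapsackGap m x) / 2 ^ m := by gcongr

/-- The closing arithmetic of the proof of Thm 5.4, in logarithms: with `B ≥ 16`, `y = 1/(8m³)`,
`E f ≥ 2^{-(m+3)}`, `log m ≤ (log 2/36) m`, `m ≥ 25` and `t ≤ m + 1`, the bound of Thm 3.8
`B^{m/4} y^{3/2} √(E f)` is at least `2^{t/8}`. [cite: LeeRaghavendraSteurer2015, Thm 5.4 proof (p. 23: "an easy calculation shows that rk_psd(M_n^f) ≥ 2^{Ω(n^{2/13})}")] -/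
theorem thm54_bound_ge {B y Ef t mR : ℝ} (hB0 : 0 < B) (hy0 : 0 < y) (hEf0 : 0 < Ef)
    (hm25 : 25 ≤ mR) (hmt1 : t ≤ mR + 1) (hlogB : 4 * Real.log 2 ≤ Real.log B)
    (hlogy : Real.log y = -(3 * Real.log 2 + 3 * Real.log mR))
    (hlogEf : -((mR + 3) * Real.log 2) ≤ Real.log Ef)
    (hlogm : Real.log mR ≤ Real.log 2 / 36 * mR) :
    (2 : ℝ) ^ ((1 / 8 : ℝ) * t) ≤ B ^ (mR / 4) * y ^ ((3 : ℝ) / 2) * Real.sqrt Ef := by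
  have hlog2 : 0 < Real.log 2 := Real.log_pos one_lt_two
  have hΨ0 : 0 < B ^ (mR / 4) * y ^ ((3 : ℝ) / 2) * Real.sqrt Ef := by positivity
  have hlogΨ : Real.log (B ^ (mR / 4) * y ^ ((3 : ℝ) / 2) * Real.sqrt Ef) =
      mR / 4 * Real.log B + 3 / 2 * Real.log y + Real.log Ef / 2 := by
    rw [Real.log_mul (by positivity) (by positivity), Real.log_mul (by positivity) (by positivity),
      Real.log_rpow hB0, Real.log_rpow hy0, Real.log_sqrt hEf0.le]
  rw [Real.rpow_def_of_pos two_pos, ← Real.exp_log hΨ0, Real.exp_le_exp, hlogΨ, hlogy]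
  have h1 : Real.log 2 * t ≤ Real.log 2 * (mR + 1) := mul_le_mul_of_nonneg_left (by linarith) hlog2.le
  have h2 : mR / 4 * (4 * Real.log 2) ≤ mR / 4 * Real.log B :=
    mul_le_mul_of_nonneg_left hlogB (by linarith)
  nlinarith

/-- **The asymptotic regime of the proof of Thm 5.4:** there is `N₀` such that for every `n ≥ N₀` and
every `r < 2^{n^{2/13}/8}`, the pattern matrix `M_n^f` of the function `f` of eq. (5.1) on
`m = 2⌊n^{2/13}/2⌋ + 1` coordinates has no psd factorisation of size `r` — Thm 3.8 with `d = m`,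
`ε = 1/(8m²)`, the knapsack pseudo-density (`‖D‖_∞ ≤ m`) and `E f ≥ 2^{-(m+3)}`, whose bound is
`≥ 2^{n^{2/13}/8}` once `c n ≥ 128 m^6 log n` and `m` is large ("choosing `n ≥ (2/α') m^{13/2} log n`,
an easy calculation shows …", p. 23). [cite: LeeRaghavendraSteurer2015, Thm 5.4 proof (p. 23)] -/
theorem thm54_large (h38 : LeeRaghavendraSteurer2015_thm38) :
    ∃ N₀ : ℕ, ∀ n : ℕ, N₀ ≤ n → ∀ r : ℕ,
      (r : ℝ) < (2 : ℝ) ^ ((1 / 8 : ℝ) * (n : ℝ) ^ ((2 : ℝ) / 13)) →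
      ∃ m : ℕ, Odd m ∧ 1 ≤ m ∧ ¬ HasPsdFactorization (patternMatrix n (knapsackGap m)) r := by
  obtain ⟨c, hc, H38⟩ := h38
  have hlog2 : 0 < Real.log 2 := Real.log_pos one_lt_two
  -- (E0) `log y ≤ (log 2 / 36) y` for `y ≥ M₀`
  obtain ⟨M₀, hM₀⟩ : ∃ M₀ : ℝ, ∀ y : ℝ, M₀ ≤ y → Real.log y ≤ Real.log 2 / 36 * y := by
    have hb := Real.isLittleO_log_id_atTop.bound (show (0 : ℝ) < Real.log 2 / 36 by positivity)
    obtain ⟨M₀, hM₀⟩ := Filter.eventually_atTop.1 (hb.and (Filter.eventually_ge_atTop (1 : ℝ)))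
    refine ⟨M₀, fun y hy => ?_⟩
    obtain ⟨h1, h2⟩ := hM₀ y hy
    rw [id, Real.norm_eq_abs, Real.norm_eq_abs, abs_of_nonneg (Real.log_nonneg h2),
      abs_of_nonneg (by linarith)] at h1
    exact h1
  -- (E3) `8192 log x ≤ c x^{1/13}` and (E1) `x^{2/13} ≥ T₀` eventually
  have hE3 : ∀ᶠ x : ℝ in atTop, 8192 * Real.log x ≤ c * x ^ ((1 : ℝ) / 13) := by
    have hb := (isLittleO_log_rpow_atTop (show (0 : ℝ) < 1 / 13 by norm_num)).bound
      (show (0 : ℝ) < c / 8192 by positivity)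
    filter_upwards [hb, Filter.eventually_ge_atTop (1 : ℝ)] with x hx hx1
    rw [Real.norm_eq_abs, Real.norm_eq_abs, abs_of_nonneg (Real.log_nonneg hx1),
      abs_of_nonneg (Real.rpow_nonneg (by linarith) _)] at hx
    linarith
  have hT : ∀ᶠ x : ℝ in atTop, max (M₀ + 1) 26 ≤ x ^ ((2 : ℝ) / 13) :=
    (tendsto_rpow_atTop (by norm_num : (0 : ℝ) < 2 / 13)).eventually_ge_atTop _
  obtain ⟨N₀, hN₀⟩ := Filter.eventually_atTop.1
    (tendsto_natCast_atTop_atTop.eventually (hE3.and hT))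
  refine ⟨max N₀ 1, fun n hn r hr => ?_⟩
  obtain ⟨hlog, ht⟩ := hN₀ n (le_trans (le_max_left _ _) hn)
  have hn1 : 1 ≤ n := le_trans (le_max_right _ _) hn
  have hnR : (1 : ℝ) ≤ n := by exact_mod_cast hn1
  have hn0 : (0 : ℝ) < n := by linarith
  obtain ⟨t, htdef⟩ : ∃ t : ℝ, t = (n : ℝ) ^ ((2 : ℝ) / 13) := ⟨_, rfl⟩
  rw [← htdef] at ht hr
  have ht26 : 26 ≤ t := le_trans (le_max_right _ _) ht
  have htM : M₀ + 1 ≤ t := le_trans (le_max_left _ _) ht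
  -- `n > 1` (else `t = 1`) and `log n > 0`
  have hn2 : (1 : ℝ) < n := by
    by_contra hle
    have h1 : (n : ℝ) = 1 := le_antisymm (not_lt.1 hle) hnR
    have : t = 1 := by rw [htdef, h1, Real.one_rpow]
    linarith
  have hlogn : 0 < Real.log n := Real.log_pos hn2
  -- `m = 2⌊t/2⌋ + 1`
  obtain ⟨q, hq⟩ : ∃ q : ℕ, q = ⌊t / 2⌋₊ := ⟨_, rfl⟩
  have hqle : (q : ℝ) ≤ t / 2 := by rw [hq]; exact Nat.floor_le (by linarith)
  have hqge : t / 2 - 1 ≤ (q : ℝ) := by rw [hq]; exact (Nat.sub_one_lt_floor _).le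
  obtain ⟨m, hmdef⟩ : ∃ m : ℕ, m = 2 * q + 1 := ⟨_, rfl⟩
  have hmR : (m : ℝ) = 2 * q + 1 := by rw [hmdef]; push_cast; ring
  have hmt1 : (m : ℝ) ≤ t + 1 := by rw [hmR]; linarith
  have hmt2 : t - 1 ≤ (m : ℝ) := by rw [hmR]; linarith
  have hm25 : (25 : ℝ) ≤ m := by linarith
  have hm3 : 3 ≤ m := by exact_mod_cast (show (3 : ℝ) ≤ m by linarith)
  have hmM : M₀ ≤ m := by linarith
  have hm0 : (0 : ℝ) < m := by linarith
  have hmne : (m : ℝ) ≠ 0 := hm0.ne'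
  have hmodd : Odd m := ⟨q, hmdef⟩
  refine ⟨m, hmodd, by omega, ?_⟩
  -- the inputs of Thm 3.8
  have hf01 := knapsackGap_mem_Icc hmodd
  have hD := isPseudoDensity_knapsackDensity (m := m) (d := m) le_rfl
  have hK := abs_knapsackDensity_le hmodd
  have hε0 : (0 : ℝ) < 1 / (8 * (m : ℝ) ^ 2) := by positivity
  have hε1 : 1 / (8 * (m : ℝ) ^ 2) ≤ 1 := by
    rw [div_le_one (by positivity)]; nlinarith
  have hneg : cubeExpect (fun x => knapsackDensity m ((m : ℝ) / 2) x * knapsackGap m x) <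
      -(1 / (8 * (m : ℝ) ^ 2)) := by
    rw [cubeExpect_knapsackDensity_mul_knapsackGap (by omega), neg_lt_neg_iff]
    exact one_div_lt_one_div_of_lt (by positivity) (by nlinarith)
  have h2m : 2 * m ≤ n := by
    have ht2 : t ^ 2 ≤ n := by
      have he : (2 : ℝ) / 13 * ((2 : ℕ) : ℝ) = 4 / 13 := by norm_num
      rw [htdef, ← Real.rpow_natCast, ← Real.rpow_mul hn0.le, he]
      calc (n : ℝ) ^ ((4 : ℝ) / 13) ≤ (n : ℝ) ^ (1 : ℝ) :=
            Real.rpow_le_rpow_of_exponent_le hnR (by norm_num)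
        _ = n := Real.rpow_one _
    have : (2 : ℝ) * m ≤ n := by nlinarith
    exact_mod_cast this
  refine H38 m m (by omega) (by omega) (knapsackGap m) hf01 (1 / (8 * (m : ℝ) ^ 2)) hε0 hε1
    (knapsackDensity m ((m : ℝ) / 2)) (m : ℝ) hD hK hneg n h2m r (lt_of_lt_of_le hr ?_)
  clear H38 hD hK hneg hf01
  -- `B = c ε n/(d m² K log n) = c n/(8 m^6 log n) ≥ 16`
  have hm6 : (m : ℝ) ^ 6 ≤ 64 * (n : ℝ) ^ ((12 : ℝ) / 13) := by
    have h2t : (m : ℝ) ≤ 2 * t := by linarith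
    have he : (2 : ℝ) / 13 * ((6 : ℕ) : ℝ) = 12 / 13 := by norm_num
    have ht6 : t ^ 6 = (n : ℝ) ^ ((12 : ℝ) / 13) := by
      rw [htdef, ← Real.rpow_natCast, ← Real.rpow_mul hn0.le, he]
    calc (m : ℝ) ^ 6 ≤ (2 * t) ^ 6 := pow_le_pow_left₀ hm0.le h2t 6
      _ = 64 * t ^ 6 := by ring
      _ = 64 * (n : ℝ) ^ ((12 : ℝ) / 13) := by rw [ht6]
  have hsplit : (n : ℝ) ^ ((12 : ℝ) / 13) * (n : ℝ) ^ ((1 : ℝ) / 13) = n := by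
    rw [← Real.rpow_add hn0]; norm_num
  have hcn : 128 * (m : ℝ) ^ 6 * Real.log n ≤ c * n := by
    have hn12 : (0 : ℝ) ≤ (n : ℝ) ^ ((12 : ℝ) / 13) := Real.rpow_nonneg hn0.le _
    calc 128 * (m : ℝ) ^ 6 * Real.log n
        ≤ 128 * (64 * (n : ℝ) ^ ((12 : ℝ) / 13)) * Real.log n := by gcongr
      _ = (n : ℝ) ^ ((12 : ℝ) / 13) * (8192 * Real.log n) := by ring
      _ ≤ (n : ℝ) ^ ((12 : ℝ) / 13) * (c * (n : ℝ) ^ ((1 : ℝ) / 13)) :=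
          mul_le_mul_of_nonneg_left hlog hn12
      _ = c * ((n : ℝ) ^ ((12 : ℝ) / 13) * (n : ℝ) ^ ((1 : ℝ) / 13)) := by ring
      _ = c * n := by rw [hsplit]
  have hlogne : Real.log n ≠ 0 := hlogn.ne'
  have hBeq : c * (1 / (8 * (m : ℝ) ^ 2)) * n / ((m : ℝ) * (m : ℝ) ^ 2 * (m : ℝ) * Real.log n) =
      c * n / (8 * (m : ℝ) ^ 6 * Real.log n) := by
    field_simp
  have hB16 : (16 : ℝ) ≤ c * (1 / (8 * (m : ℝ) ^ 2)) * n / ((m : ℝ) * (m : ℝ) ^ 2 * (m : ℝ) * Real.log n) := by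
    rw [hBeq, le_div_iff₀ (by positivity)]; linarith
  have hB0 : 0 < c * (1 / (8 * (m : ℝ) ^ 2)) * n / ((m : ℝ) * (m : ℝ) ^ 2 * (m : ℝ) * Real.log n) := by
    linarith
  have hy0 : 0 < 1 / (8 * (m : ℝ) ^ 2) / (m : ℝ) := by positivity
  have hEf : (1 : ℝ) / 2 ^ (m + 3) ≤ cubeExpect (knapsackGap m) := cubeExpect_knapsackGap_ge hmodd hm3
  have hEf0 : 0 < cubeExpect (knapsackGap m) := lt_of_lt_of_le (by positivity) hEf
  -- logarithms of the three factors
  have hlogB : 4 * Real.log 2 ≤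
      Real.log (c * (1 / (8 * (m : ℝ) ^ 2)) * n / ((m : ℝ) * (m : ℝ) ^ 2 * (m : ℝ) * Real.log n)) := by
    rw [show (4 : ℝ) * Real.log 2 = Real.log 16 by
      rw [show (16 : ℝ) = 2 ^ 4 by norm_num, Real.log_pow]; norm_num]
    exact Real.log_le_log (by norm_num) hB16
  have hlogy : Real.log (1 / (8 * (m : ℝ) ^ 2) / (m : ℝ)) = -(3 * Real.log 2 + 3 * Real.log m) := by
    rw [Real.log_div hε0.ne' hmne, Real.log_div one_ne_zero (by positivity), Real.log_one,
      Real.log_mul (by norm_num) (by positivity), Real.log_pow, show (8 : ℝ) = 2 ^ 3 by norm_num,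
      Real.log_pow]
    push_cast
    ring
  have hlogEf : -(((m : ℝ) + 3) * Real.log 2) ≤ Real.log (cubeExpect (knapsackGap m)) := by
    have h1 : Real.log ((1 : ℝ) / 2 ^ (m + 3)) = -(((m : ℝ) + 3) * Real.log 2) := by
      rw [Real.log_div one_ne_zero (by positivity), Real.log_one, Real.log_pow]; push_cast; ring
    rw [← h1]
    exact Real.log_le_log (by positivity) hEf
  have hlogm : Real.log m ≤ Real.log 2 / 36 * m := hM₀ m hmM
  have hexp : ((m : ℕ) : ℝ) / 4 = (m : ℝ) / 4 := rfl
  exact thm54_bound_ge hB0 hy0 hEf0 hm25 (by linarith) hlogB hlogy hlogEf hlogm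

/-- **Lee–Raghavendra–Steurer 2015, Theorem 1.1 (= Thm 5.4) DERIVED from Theorem 3.8:**
`rk_psd(CORR_n) ≥ 2^{α n^{2/13}}` — the named fact `LeeRaghavendraSteurer2015_thm11` follows from
the typed engine `LeeRaghavendraSteurer2015_thm38` alone, through the printed route: Grigoriev's
knapsack pseudo-density of small norm (Thm 5.3, PROVED above), the nonnegative quadratic `f` of
eq. (5.1), Thm 3.8 for `M_n^f` with `m ≍ n^{2/13}` (`thm54_large`), and Prop. 5.1 = 1.11
(`HasPsdFactorization.patternMatrix_of_corrSlack`: `M_n^f` is a submatrix of the slack matrix of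
`CORR_n`); sizes `r ≤ 1`, the only ones allowed by the bound for small `n` with our `α`, are excluded
directly (`corrSlack_not_hasPsdFactorization_le_one`).
[cite: LeeRaghavendraSteurer2015, Thm 1.1 (p. 3) = Thm 5.4 and its proof (p. 23)] -/
theorem LeeRaghavendraSteurer2015_thm11_of_thm38 (h38 : LeeRaghavendraSteurer2015_thm38) :
    LeeRaghavendraSteurer2015_thm11 := by
  obtain ⟨N₀, hN₀⟩ := thm54_large h38
  set α : ℝ := min (1 / 8) (1 / ((N₀ : ℝ) + 1)) with hαdef
  have hα8 : α ≤ 1 / 8 := min_le_left _ _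
  have hαN : α ≤ 1 / ((N₀ : ℝ) + 1) := min_le_right _ _
  have hα0 : 0 < α := lt_min (by norm_num) (by positivity)
  refine ⟨α, hα0, fun n hn r hr => ?_⟩
  have hnR : (1 : ℝ) ≤ n := by exact_mod_cast hn
  have hn0 : (0 : ℝ) ≤ n := by linarith
  have ht0 : 0 ≤ (n : ℝ) ^ ((2 : ℝ) / 13) := Real.rpow_nonneg hn0 _
  by_cases hsmall : n ≤ N₀
  · -- small `n`: the bound only allows `r ≤ 1`
    have hr1 : r ≤ 1 := by
      have hexp : α * (n : ℝ) ^ ((2 : ℝ) / 13) < 1 := by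
        have h1 : (n : ℝ) ^ ((2 : ℝ) / 13) ≤ n := by
          calc (n : ℝ) ^ ((2 : ℝ) / 13) ≤ (n : ℝ) ^ (1 : ℝ) :=
                Real.rpow_le_rpow_of_exponent_le hnR (by norm_num)
            _ = n := Real.rpow_one _
        have h2 : (n : ℝ) < (N₀ : ℝ) + 1 := by exact_mod_cast Nat.lt_succ_of_le hsmall
        have h3 : α * (n : ℝ) ^ ((2 : ℝ) / 13) ≤ 1 / ((N₀ : ℝ) + 1) * n :=
          mul_le_mul hαN h1 ht0 (by positivity)
        have h4 : 1 / ((N₀ : ℝ) + 1) * n < 1 := by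
          rw [div_mul_eq_mul_div, one_mul, div_lt_one (by positivity)]; exact h2
        linarith
      have h2 : (2 : ℝ) ^ (α * (n : ℝ) ^ ((2 : ℝ) / 13)) < 2 := by
        calc (2 : ℝ) ^ (α * (n : ℝ) ^ ((2 : ℝ) / 13)) < (2 : ℝ) ^ (1 : ℝ) :=
              Real.rpow_lt_rpow_of_exponent_lt one_lt_two hexp
          _ = 2 := Real.rpow_one _
      have : (r : ℝ) < 2 := hr.trans h2
      have : r < 2 := by exact_mod_cast this
      omega
    exact corrSlack_not_hasPsdFactorization_le_one hn hr1
  · -- large `n`: Thm 3.8 through the pattern matrix of `f`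
    push Not at hsmall
    have hr' : (r : ℝ) < (2 : ℝ) ^ ((1 / 8 : ℝ) * (n : ℝ) ^ ((2 : ℝ) / 13)) :=
      hr.trans_le (Real.rpow_le_rpow_of_exponent_le one_le_two
        (mul_le_mul_of_nonneg_right hα8 ht0))
    obtain ⟨m, hmodd, hm1, hnot⟩ := hN₀ n hsmall.le r hr'
    rintro ⟨U, V, hU, hV, hfac⟩
    exact hnot (HasPsdFactorization.patternMatrix_of_corrSlack (isCubeQuadratic_knapsackGap hm1)
      (fun x => (knapsackGap_mem_Icc hmodd x).1) U V hU hV hfac)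

/-- **Lee–Raghavendra–Steurer 2015, Corollary 1.2 (cut polytope: `rk_psd(CUT_n) ≥ 2^{α n^{2/13}}`)
DERIVED from Theorem 3.8**, composing `LeeRaghavendraSteurer2015_thm11_of_thm38` with the De Simone
isomorphism `CUT_{n+1} ≅ CORR_n` step `LeeRaghavendraSteurer2015_cor12_cut_of_thm11`
(`CutTspStabPsdRank.lean`). [cite: LeeRaghavendraSteurer2015, Cor. 1.2 (p. 4) and Prop. 5.2 (p. 22)] -/
theorem LeeRaghavendraSteurer2015_cor12_cut_of_thm38 (h38 : LeeRaghavendraSteurer2015_thm38) :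
    LeeRaghavendraSteurer2015_cor12_cut :=
  LeeRaghavendraSteurer2015_cor12_cut_of_thm11 (LeeRaghavendraSteurer2015_thm11_of_thm38 h38)

end Thm54

end Literature.Combinatorics.Optimization

end
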